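import Summits.QuantumFields.YangMills.Theorems.TransportPerturbationSynchronousShadowCouplingToWeighted
import Summits.QuantumFields.YangMills.Theorems.TransportPerturbationTopRegularMass
import Summits.QuantumFields.YangMills.Theorems.TransportPerturbationSolutionFamily
import HarnessLib

/-!
# Route `TransportPerturbation`, LINE 16 «synchronous_shadow»: the skeleton's compositions WITH THE LANDED STUBS PLUGGED IN —
# item `RegularWindowShadow` (stmt-QuantumFields-27784) and crux `WeightedAlmostInvariance` (stmt-QuantumFields-26987) BY NAME,
# modulo exactly the load-bearing stub `stub_synchronousCoupling` (and, for the crux, the shared stub `stub_fineWindowIdentity`)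

Planner ym-idea-5 g11's registered skeleton `SynchronousShadow.lean` (sha eb632437…) composes
`regularWindowShadow_of_coupling : L → C → W → RegularWindowShadow` and `WeightedAlmostInvariance_of : FWI → L → C → W →
WeightedAlmostInvariance` (kernel-checked, no sorry outside the stubs).  Stubs L (`stub_lawTransfer`, p657511) and W
(`stub_couplingToWeighted`, p658152) are LANDED; this file re-runs the two compositions verbatim with L and W discharged, so that
the tree holds the line's state as theorems:

* `regularWindowShadow_of_synchronousCoupling : __Registered.stub_synchronousCoupling → RegularWindowShadow` (item 27784 BY NAME
  from the ONE remaining registered stub);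
* `weightedAlmostInvariance_of_synchronousCoupling :
    __Registered.stub_fineWindowIdentity → __Registered.stub_synchronousCoupling → WeightedAlmostInvariance` (crux 26987 BY NAME;
  `stub_fineWindowIdentity` is the route item `GibbsInvariance` 26921 on `g ∘ descend`, see
  `Theorems.TransportPerturbationSynchronousShadowFineWindowIdentityOfGibbsInvariance`).

When `stub_synchronousCoupling` lands, closing 27784 is the one-liner `regularWindowShadow_of_synchronousCoupling stub_synchronousCoupling`.
Cell `ym-idea-1` extra width seat `ym-line-sfw-p2-w5` gen 9 (free hands).  HONEST FRAMING: CONDITIONAL compositions — the hypotheses are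
registered stubs that are NOT proved here (C is the dynamics organ's UV-mismatch wall, XL); nothing is closed; no crux, item, rung or summit
is proved; the Yang–Mills mass gap is NOT proved by any of this (R3 is a RECORD rung).
-/

set_option autoImplicit false

noncomputable section

namespace Summit.QuantumFields.YangMills.Cruxes.WeightedAlmostInvariance.SynchronousShadow

open scoped BigOperators Topology Classical MeasureTheory ProbabilityTheory NNReal ENNReal
open Filter Set Function MeasureTheory
open Literature.MathematicalPhysics.QuantumFieldTheory
open Literature.MathematicalPhysics.QuantumFieldTheory.Balaban1983to89
open Literature.MathematicalPhysics.QuantumLattice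

/-! ## The skeleton's compositions (verbatim, planner ym-idea-5 g11) -/

/-- **Item 27784 from the three new stubs**: one coupling per regular start (C), transfer of the four transition values to the
coupling space (L), Cauchy–Schwarz in the weighted class (W). -/
theorem regularWindowShadow_of_coupling (hL : __Registered.stub_lawTransfer) (hC : __Registered.stub_synchronousCoupling)
    (hW : __Registered.stub_couplingToWeighted) :
    Summit.QuantumFields.YangMills.Theses.TransportPerturbation.RegularWindowShadow := by
  obtain ⟨a, ha0, ha1, γ₁, hγ₁, hC'⟩ := hC
  refine ⟨a, ha0, ha1, γ₁, hγ₁, fun F γ hγ hγle τ hτ => ?_⟩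
  obtain ⟨ρ, hρ0, hρs, hK⟩ := hC' F γ hγ hγle τ hτ
  refine ⟨ρ, hρ0, hρs, ?_⟩
  intro K Ω mΩ P hP W hWf V hV Ω' mΩ' P' hP' W' hW' V' hV'
  have hV₀ : IsSolFamily F γ K P W hWf V := hV
  have hV₁ : IsSolFamily F γ (K + 1) P' W' hW' V' := hV'
  change PointwiseClause F (thr F γ a K) K P V (τ / (F.P K).eps).toNNReal P' V' (τ / (F.P (K + 1)).eps).toNNReal (ρ K)
  intro U hU Λ hΛm hΛ0 hΛb A g hg
  obtain ⟨Ωc, mΩc, Pc, hPc, Wc', hWc', Vc', Wc, hWc, Vc, hVc', hVc, hmeas, hbound⟩ := hK K U hU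
  have hg' : InClsW F K Λ A g := hg
  have hdesc : Measurable (T3NestedUnitLaws.descend F avSU K : GaugeField (F.P (K + 1)) 0 G2 → GaugeField (F.P K) 0 G2) :=
    T3NestedUnitLaws.measurable_descend F avSU T4ApexTwoLevel.measurableE_expMeanLogSU K
  have hTo : Measurable (toField F (K + 1)) :=
    measurable_pi_lambda _ (fun b => measurable_pi_apply (b.src, b.dir))
  have hDc : Measurable (descendCfg F K) :=
    measurable_pi_lambda _ (fun e => (measurable_pi_apply (⟨e.1, e.2⟩ : PBond (F.P K) 0)).comp (hdesc.comp hTo))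
  -- transfer the four transition values to the coupling space (uniqueness in law)
  have e1 : markovTransition V' P' (τ / (F.P (K + 1)).eps).toNNReal (g ∘ descendCfg F K) (fun e => U ⟨e.1, e.2⟩) =
      markovTransition Vc' Pc (τ / (F.P (K + 1)).eps).toNNReal (g ∘ descendCfg F K) (fun e => U ⟨e.1, e.2⟩) :=
    hL F γ (K + 1) Ω' mΩ' P' hP' W' hW' V' hV₁ Ωc mΩc Pc hPc Wc' hWc' Vc' hVc' _ _ (hg'.1.comp hDc) _
  have e2 : markovTransition V' P' (τ / (F.P (K + 1)).eps).toNNReal (Λ ∘ descendCfg F K) (fun e => U ⟨e.1, e.2⟩) =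
      markovTransition Vc' Pc (τ / (F.P (K + 1)).eps).toNNReal (Λ ∘ descendCfg F K) (fun e => U ⟨e.1, e.2⟩) :=
    hL F γ (K + 1) Ω' mΩ' P' hP' W' hW' V' hV₁ Ωc mΩc Pc hPc Wc' hWc' Vc' hVc' _ _ (hΛm.comp hDc) _
  have e3 : markovTransition V P (τ / (F.P K).eps).toNNReal g (fun e => T3NestedUnitLaws.descend F
        (ExpMeanLog.expMeanLogSU : LoopAverage (Matrix.specialUnitaryGroup (Fin 2) ℂ)) K U ⟨e.1, e.2⟩) =
      markovTransition Vc Pc (τ / (F.P K).eps).toNNReal g (fun e => T3NestedUnitLaws.descend F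
        (ExpMeanLog.expMeanLogSU : LoopAverage (Matrix.specialUnitaryGroup (Fin 2) ℂ)) K U ⟨e.1, e.2⟩) :=
    hL F γ K Ω mΩ P hP W hWf V hV₀ Ωc mΩc Pc hPc Wc hWc Vc hVc _ _ hg'.1 _
  have e4 : markovTransition V P (τ / (F.P K).eps).toNNReal Λ (fun e => T3NestedUnitLaws.descend F
        (ExpMeanLog.expMeanLogSU : LoopAverage (Matrix.specialUnitaryGroup (Fin 2) ℂ)) K U ⟨e.1, e.2⟩) =
      markovTransition Vc Pc (τ / (F.P K).eps).toNNReal Λ (fun e => T3NestedUnitLaws.descend F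
        (ExpMeanLog.expMeanLogSU : LoopAverage (Matrix.specialUnitaryGroup (Fin 2) ℂ)) K U ⟨e.1, e.2⟩) :=
    hL F γ K Ω mΩ P hP W hWf V hV₀ Ωc mΩc Pc hPc Wc hWc Vc hVc _ _ hΛm _
  rw [e1, e2, e3, e4]
  -- the coupled random configurations and Cauchy–Schwarz
  have hXm : Measurable (fun ω => descendCfg F K (Vc' (fun e => U ⟨e.1, e.2⟩) (τ / (F.P (K + 1)).eps).toNNReal ω)) :=
    hDc.comp ((hVc'.2 _).comp measurable_prodMk_left)
  have hYm : Measurable (fun ω => Vc (fun e => T3NestedUnitLaws.descend F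
      (ExpMeanLog.expMeanLogSU : LoopAverage (Matrix.specialUnitaryGroup (Fin 2) ℂ)) K U ⟨e.1, e.2⟩)
      (τ / (F.P K).eps).toNNReal ω) :=
    (hVc.2 _).comp measurable_prodMk_left
  exact hW F K Ωc mΩc Pc hPc _ _ hXm hYm hmeas (ρ K) (hρ0 K) hbound Λ hΛm hΛ0 hΛb A g hg'

/-- **The crux `WeightedAlmostInvariance` (26987) BY NAME from the four stubs of r3**, through the LANDED route items
`TopRegularMass` (`topRegularMass_proof`), `ShadowAveraging` (`shadowAveraging_proof`) and `SolutionFamily`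
(`solutionFamily_proof`): the r2 composition with its XL stub discharged by `regularWindowShadow_of_coupling`. -/
theorem WeightedAlmostInvariance_of (h1 : __Registered.stub_fineWindowIdentity) (hL : __Registered.stub_lawTransfer)
    (hC : __Registered.stub_synchronousCoupling) (hW : __Registered.stub_couplingToWeighted) :
    Summit.QuantumFields.YangMills.Theses.TransportPerturbation.WeightedAlmostInvariance := by
  have hS : Summit.QuantumFields.YangMills.Theses.TransportPerturbation.SolutionFamily :=
    Summit.QuantumFields.YangMills.Theorems.TransportPerturbation.solutionFamily_proof
  have h2 : Summit.QuantumFields.YangMills.Theses.TransportPerturbation.TopRegularMass :=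
    Summit.QuantumFields.YangMills.Theorems.TransportPerturbationRegularShadow.topRegularMass_proof
  have h3 : Summit.QuantumFields.YangMills.Theses.TransportPerturbation.RegularWindowShadow :=
    regularWindowShadow_of_coupling hL hC hW
  have h4 : Summit.QuantumFields.YangMills.Theses.TransportPerturbation.ShadowAveraging :=
    Summit.QuantumFields.YangMills.Theorems.TransportPerturbation.shadowAveraging_proof
  obtain ⟨a, ha0, ha1, γ₁, hγ₁, h3'⟩ := h3
  refine ⟨γ₁, hγ₁, fun F γ hγ hγle τ hτ => ?_⟩
  obtain ⟨e, he0, hse, hmass⟩ := h2 a ha0 ha1 F γ hγ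
  obtain ⟨ρ, hρ0, hρs, hK⟩ := h3' F γ hγ hγle τ hτ
  refine ⟨fun K => ρ K + 2 * Real.sqrt (e K), hρs.add (hse.mul_left 2), ?_⟩
  intro K Ω mΩ P hP W hW V hV Λ hΛm hΛ0 hΛb A g hg
  obtain ⟨Ω', mΩ', P', hP', W', hW', V', hV'⟩ := hS F γ hγ (K + 1)
  have hV₀ : IsSolFamily F γ K P W hW V := hV
  have hV₁ : IsSolFamily F γ (K + 1) P' W' hW' V' := hV'
  have hg' : InClsW F K Λ A g := hg
  have hid : IdentityClause F γ K P' V' (τ / (F.P (K + 1)).eps).toNNReal :=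
    fun g₀ hg₀ hg₀' => h1 F γ hγ τ hτ K Ω' mΩ' P' hP' W' hW' V' hV₁ g₀ hg₀ hg₀'
  have hμ : IsProbabilityMeasure (gibbsSucc F γ K) :=
    T4GenFunBounds.isProbabilityMeasure_gibbsMeasure (G := G2) (F.P (K + 1)) (F.scheme_β_nonneg avSU hγ.le (K + 1))
  have hdesc : Measurable (T3NestedUnitLaws.descend F avSU K : GaugeField (F.P (K + 1)) 0 G2 → GaugeField (F.P K) 0 G2) :=
    T3NestedUnitLaws.measurable_descend F avSU T4ApexTwoLevel.measurableE_expMeanLogSU K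
  have hE : Measurable (fun (U : GaugeField (F.P (K + 1)) 0 G2) => (fun e => U ⟨e.1, e.2⟩ : Cfg F (K + 1))) :=
    measurable_pi_lambda _ (fun e => measurable_pi_apply (⟨e.1, e.2⟩ : PBond (F.P (K + 1)) 0))
  have hD : Measurable (fun (U : GaugeField (F.P (K + 1)) 0 G2) =>
      (fun e => T3NestedUnitLaws.descend F avSU K U ⟨e.1, e.2⟩ : Cfg F K)) :=
    measurable_pi_lambda _ (fun e => (measurable_pi_apply (⟨e.1, e.2⟩ : PBond (F.P K) 0)).comp hdesc)
  have hTo : Measurable (toField F (K + 1)) :=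
    measurable_pi_lambda _ (fun b => measurable_pi_apply (b.src, b.dir))
  have hDc : Measurable (descendCfg F K) :=
    measurable_pi_lambda _ (fun e => (measurable_pi_apply (⟨e.1, e.2⟩ : PBond (F.P K) 0)).comp (hdesc.comp hTo))
  have hR : MeasurableSet {U : GaugeField (F.P (K + 1)) 0 G2 | PlaqSmall (thr F γ a K) U} :=
    T3UnitScaleTilt.measurableSet_plaqSmall _
  exact h4 F K (wdisc F K) rfl (GaugeField (F.P (K + 1)) 0 G2) (Cfg F (K + 1)) Ω Ω'
    (gibbsSucc F γ K) P P' hμ hP hP' V (τ / (F.P K).eps).toNNReal V' (τ / (F.P (K + 1)).eps).toNNReal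
    (fun U e => U ⟨e.1, e.2⟩) (descendCfg F K) (fun U e => T3NestedUnitLaws.descend F avSU K U ⟨e.1, e.2⟩)
    (fun U => PlaqSmall (thr F γ a K) U) (e K) (ρ K) (hV₀.2 _) (hV₁.2 _) hE hDc hD hR (he0 K) (hρ0 K)
    (hmass K) (hK K Ω mΩ P hP W hW V hV₀ Ω' mΩ' P' hP' W' hW' V' hV₁) hid Λ hΛm hΛ0 hΛb A g hg'



/-! ## With the landed stubs L and W plugged in -/

/-- **Item `RegularWindowShadow` (stmt-QuantumFields-27784) BY NAME from the ONE remaining registered stub** `stub_synchronousCoupling`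
(L = `stub_lawTransfer` p657511 and W = `stub_couplingToWeighted` p658152 are theorems of the tree).  CONDITIONAL: C is not proved here.
[cite: HairerMattinglyScheutzow2011, §4] -/
theorem regularWindowShadow_of_synchronousCoupling (hC : __Registered.stub_synchronousCoupling) :
    Summit.QuantumFields.YangMills.Theses.TransportPerturbation.RegularWindowShadow :=
  regularWindowShadow_of_coupling stub_lawTransfer hC stub_couplingToWeighted

/-- **Crux `WeightedAlmostInvariance` (stmt-QuantumFields-26987) BY NAME from the two remaining registered stubs** — the shared
`stub_fineWindowIdentity` (= route item `GibbsInvariance` 26921 on `g ∘ descend`) and the load-bearing `stub_synchronousCoupling` — through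
the LANDED route items `TopRegularMass`, `ShadowAveraging`, `SolutionFamily` and the landed stubs L, W.  CONDITIONAL: neither hypothesis is
proved here. [cite: HairerMattinglyScheutzow2011, §4] -/
theorem weightedAlmostInvariance_of_synchronousCoupling (h1 : __Registered.stub_fineWindowIdentity)
    (hC : __Registered.stub_synchronousCoupling) :
    Summit.QuantumFields.YangMills.Theses.TransportPerturbation.WeightedAlmostInvariance :=
  WeightedAlmostInvariance_of h1 stub_lawTransfer hC stub_couplingToWeighted

end Summit.QuantumFields.YangMills.Cruxes.WeightedAlmostInvariance.SynchronousShadow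

end
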